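import Summits.QuantumFields.YangMills.Theorems.BalabanLadderIRRankPurityDefs
import Summits.QuantumFields.YangMills.Theorems.BalabanLadderIRLightCodePincer
import HarnessLib

/-!
# `BalabanLadder.IR` ∕ `IRcof` helper — rank-purity under the COFINAL quantifier, part 1: objects, statements, the `Bset` light-code seam
# (ideator ym-ir-idea-14 gen 4; `--supports stmt-QuantumFields-19354 --as helper`; sorry-free part of `Cruxes/IR/Lines/rank_purity_cofinal.lean`)

HONESTY.  Nothing here proves the Clay Yang–Mills mass gap, a lattice gap, `IRnsc`, `IRnscCof`, `IRcof` or `BalabanLadder.IR`;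
`R4` closes only the conditional finite-𝕋⁴ rung `BalabanLadder.UV`.  Every Yang–Mills input below is a HYPOTHESIS (`Prop`-valued def).

CONTENT.  §1 `RqExit r β Q θ S` (every ratio datum of the torus `(2S+1)³` at coupling `β` admits `≤ Q` excused levels with rank-`Q`
tail `≤ θ` at the canonical cold exponent) and the rank-`Q` exit length `rqLen` (least such `S ≥ S₀`; unit-free).  §2 the statements:
`IRnscCof` ∕ `IRscCof` (the `GapInUnits` clustering family on a COFINAL set of couplings, for `π₁(G) ≠ 1` ∕ `= 1` — the two conjuncts the
cofinal leaf `Theses.BalabanLadder.IRcof` consumes), K1ᴷ `RankExitsUnbounded` (cofinal rank-`Q` exits, no unit map), Xᴷ `AFToRankExit` (af-pincer's X with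
`cpLength ↦ rqLen`), BLINDᴷ′ `BlindAt` (per-coupling: W-currency at length `ξ` ⇒ light-code certificate at length `κ ξ`), `PinnedRankExitCof`,
`MultipletPinnedOn`.  §3 PROVED: `gapOn_of_lightCode_pinned_onSet` — the landed `FluxCodeBlindness.gapInUnits_of_lightCode_pinned` with onset
AND pin restricted to a coupling set `Bset` (same constants, rate `c₁ = 1/T`).  Part 2 (`BalabanLadderIRRankPurityCofinal.lean`) carries the
per-coupling seam and the compositions to `IRcof`.
-/

set_option autoImplicit false

noncomputable section

open Filter Topology MeasureTheory
open scoped BigOperators InnerProductSpace SchwartzMap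
open Literature.MathematicalPhysics.QuantumFieldTheory Literature.MathematicalPhysics.QuantumLattice
open Summit.QuantumFields.YangMills.Cruxes.OSLegsFromFemtoAndGap.DlrCollarTransfer (GapInUnits LowerBounds Q2)
open Summit.QuantumFields.YangMills.Theorems.WeakCouplingHypercubicLimit.TraceNormColdPressure
open Summit.QuantumFields.YangMills.Cruxes.IR.FluxCodeBlindness

namespace Summit.QuantumFields.YangMills.Cruxes.IR.RankPurity

/-! ## §1 Objects: rank-`Q` exits and the rank-`Q` exit length (intrinsic, unit-free) -/

section Defs

variable {G : Type} [Group G] [TopologicalSpace G] [IsTopologicalGroup G] [CompactSpace G]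
  [MeasurableSpace G] [BorelSpace G]

/-- **Rank-`Q` `θ`-exit at coupling `β` on the symmetric torus `(2S+1)³`**: every ratio datum of the cold shape admits `≤ Q` excused
levels (vacuum excluded) leaving rank-`Q` tail `≤ θ` at the canonical cold exponent.  A per-coupling, finite-volume SPECTRAL fact (no unit
map, no floors) — the rank-`Q` twin of K1's `coldDefect r.ρ β L ≤ θ`. -/
def RqExit (r : LatticeRep G) (β : ℝ) (Q : ℕ) (θ : ℝ) (S : ℕ) : Prop :=
  ∀ (ι : Type) [DecidableEq ι] (rr : ι → ℝ) (i₀ : ι), IsRatioDatum r.ρ β (2 * S + 1) ι rr i₀ →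
    ∃ F : Finset ι, i₀ ∉ F ∧ F.card ≤ Q ∧ rankTail r.ρ β (2 * S + 1) rr F (coldExp S) ≤ θ

/-- **The rank-`Q` exit length** `rqLen r β Q θ S₀` := the least half-side `S ≥ S₀` with a rank-`Q` `θ`-exit at `β` (junk `0` if none) —
the intrinsic length replacing `ColdPressurePincer.cpLength` in Xᴷ. -/
def rqLen (r : LatticeRep G) (β : ℝ) (Q : ℕ) (θ : ℝ) (S₀ : ℕ) : ℕ :=
  sInf {S : ℕ | S₀ ≤ S ∧ RqExit r β Q θ S}

/-- If SOME `S ≥ S₀` is a rank-`Q` `θ`-exit at `β`, then `rqLen r β Q θ S₀` is one (the least): `S₀ ≤ rqLen` and `RqExit` holds there. -/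
theorem rqLen_spec (r : LatticeRep G) {β : ℝ} {Q : ℕ} {θ : ℝ} {S₀ S : ℕ} (hS : S₀ ≤ S) (hex : RqExit r β Q θ S) :
    S₀ ≤ rqLen r β Q θ S₀ ∧ RqExit r β Q θ (rqLen r β Q θ S₀) :=
  Nat.sInf_mem (s := {S : ℕ | S₀ ≤ S ∧ RqExit r β Q θ S}) ⟨S, hS, hex⟩

end Defs

/-! ## §2 The statements of LINE D-cof -/

/-- **N_cof `IRnscCof` — THE NSC CONJUNCT THE COFINAL LEAF CONSUMES.** HYPOTHESIS-side `Prop` (open Yang–Mills content; NOTHING in the tree proves it).  `Theses.BalabanLadder.IRcof` restricted to `π₁(G) ≠ 1`: for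
every positive unit map `a → 0` with `LowerBounds G r a`, the `GapInUnits` clustering family holds on SOME set of couplings unbounded
above.  `IRnsc → IRnscCof` (`irnscCof_of_irnsc`); `IRscCof → IRnscCof → IRcof` (`IRcof_of_split`).  Weaker BY NAME than the N of
record; same wall (flux-sector blindness), now asked only cofinally in `β`. -/
def IRnscCof : Prop :=
  ∀ (G : Type) [Group G] [TopologicalSpace G] [IsTopologicalGroup G] [CompactSpace G],
    IsCompactSimpleLieGroup G → ¬ SimplyConnectedSpace G →
    letI : MeasurableSpace G := borel G
    haveI : BorelSpace G := ⟨rfl⟩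
    ∀ (r : LatticeRep G) (a : ℝ → ℝ), (∀ β, 0 < a β) → Tendsto a atTop (𝓝 0) → LowerBounds G r a →
      ∃ Bset : Set ℝ, (∀ x : ℝ, ∃ β ∈ Bset, x ≤ β) ∧
        ∃ (c₁ β₂ : ℝ) (S₁ : ℝ → ℕ), 0 < c₁ ∧ ∀ A B : YMSpecies G, ∃ C : ℝ, ∀ β ∈ Bset, β₂ ≤ β →
          ∀ S n : ℕ, S₁ β ≤ S → n ≤ S →
            |latticeConnectedCorr r.ρ β (2 * S + 1) A.F B.F n| ≤ C * Real.exp (-(c₁ * a β * n))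

/-- The simply-connected conjunct of `IRcof` (the LEAD's side; from the tokens of record K1 ∧ X by `irscCof_of_K1_X` in part 2). HYPOTHESIS-side `Prop` (open Yang–Mills content; NOTHING in the tree proves it). -/
def IRscCof : Prop :=
  ∀ (G : Type) [Group G] [TopologicalSpace G] [IsTopologicalGroup G] [CompactSpace G],
    IsCompactSimpleLieGroup G → SimplyConnectedSpace G →
    letI : MeasurableSpace G := borel G
    haveI : BorelSpace G := ⟨rfl⟩
    ∀ (r : LatticeRep G) (a : ℝ → ℝ), (∀ β, 0 < a β) → Tendsto a atTop (𝓝 0) → LowerBounds G r a →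
      ∃ Bset : Set ℝ, (∀ x : ℝ, ∃ β ∈ Bset, x ≤ β) ∧
        ∃ (c₁ β₂ : ℝ) (S₁ : ℝ → ℕ), 0 < c₁ ∧ ∀ A B : YMSpecies G, ∃ C : ℝ, ∀ β ∈ Bset, β₂ ≤ β →
          ∀ S n : ℕ, S₁ β ≤ S → n ≤ S →
            |latticeConnectedCorr r.ρ β (2 * S + 1) A.F B.F n| ≤ C * Real.exp (-(c₁ * a β * n))

/-- **K1ᴷ `RankExitsUnbounded` — RANK-`Q` EXITS ARE UNBOUNDED IN THE COUPLING (unit-free; the nsc twin of K1).** HYPOTHESIS-side `Prop` (open Yang–Mills content; NOTHING in the tree proves it).  For compact simple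
`G` with `π₁(G) ≠ 1` and every `r` there is a rank `Q` (intended: the number of light flux vacua) such that for every tolerance `θ > 0`,
every floor `S₀` and every `x` some coupling `β ≥ x` has a rank-`Q` `θ`-exit on some symmetric torus of half-side `≥ S₀`.  No unit
map, no `LowerBounds`, no pin: a per-coupling finite-volume statement about the transfer spectrum (engine-checkable per `β` in
principle).  Why it might fail: a deconfined ∕ Coulomb phase at all large `β` (no rank is ever pure); the rank needed grows with the
box (unscreened torelon towers at the cold shape).  Sources: tHooft1979; deForcrandJahn2003 (hep-lat/0211004 §6); Greensite2011 pp. 46–47;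
`Theorems/BalabanLadderIRColdPressureOnsetFalseOfLightFlux` (why `Q ≥ 1` is forced). -/
def RankExitsUnbounded : Prop :=
  ∀ (G : Type) [Group G] [TopologicalSpace G] [IsTopologicalGroup G] [CompactSpace G],
    IsCompactSimpleLieGroup G → ¬ SimplyConnectedSpace G →
    letI : MeasurableSpace G := borel G
    haveI : BorelSpace G := ⟨rfl⟩
    ∀ r : LatticeRep G, ∃ Q : ℕ, ∀ θ : ℝ, 0 < θ → ∀ S₀ : ℕ, ∀ x : ℝ,
      ∃ β : ℝ, x ≤ β ∧ ∃ S : ℕ, S₀ ≤ S ∧ RqExit r β Q θ S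

/-- **Xᴷ `AFToRankExit` — ASYMPTOTIC FREEDOM UP TO THE RANK-`Q` EXIT LENGTH (the nsc twin of af-pincer's X = `AFToColdPressure`,
`cpLength ↦ rqLen`).** HYPOTHESIS-side `Prop` (open Yang–Mills content; NOTHING in the tree proves it).  For every `Q`, `θ > 0`, `S₀`: for every positive-time real test function `v` and `η > 0`, a factor `T` and a
threshold `β₁` such that for `β ≥ β₁` and every spacing `s > 0` with `T ≤ s · rqLen r β Q θ S₀`, `|Q2 G r β L s (Θv) v| ≤ η` on tori of
infinitely many sizes (vacuous at couplings with no exit: `rqLen = 0`).  Quantifier order `∀ S₀ … ∃ T β₁` is load-bearing (for `β ≥ β₁(S₀)`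
the exit length is the confinement scale up to a factor `c(θ)`).  Why it might fail: as X — AF to the intrinsic IR scale is Balaban-programme
content (UV stability non-uniqueness; the crossover is not perturbative).  Sources: Balaban1983to89; `Literature.Barriers.QuantumFields.UVStabilityNonUniqueness`;
af-pincer stub X (Theorems/BalabanLadderIRColdPressurePincerDefs). -/
def AFToRankExit : Prop :=
  ∀ (G : Type) [Group G] [TopologicalSpace G] [IsTopologicalGroup G] [CompactSpace G],
    IsCompactSimpleLieGroup G → ¬ SimplyConnectedSpace G →
    letI : MeasurableSpace G := borel G
    haveI : BorelSpace G := ⟨rfl⟩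
    ∀ (r : LatticeRep G) (Q : ℕ) (θ : ℝ) (S₀ : ℕ), 0 < θ →
      ∀ v : 𝓢(EuclideanSpace ℝ (Fin 4), ℝ), tsupport v ⊆ {y : EuclideanSpace ℝ (Fin 4) | 0 < y 0} →
        ∀ η : ℝ, 0 < η → ∃ T β₁ : ℝ, ∀ β : ℝ, β₁ ≤ β → ∀ s : ℝ, 0 < s →
          T ≤ s * (rqLen r β Q θ S₀ : ℝ) →
            ∃ᶠ (L : ℕ) in atTop, |Q2 G r β L s (thetaTest 4 v) v| ≤ η

/-- **BLINDᴷ′ `BlindAt` — FLUX-CODE BLINDNESS PER COUPLING.** HYPOTHESIS-side `Prop` (open Yang–Mills content; NOTHING in the tree proves it).  For compact simple `G` with `π₁(G) ≠ 1`, every `r` and every rank `Q`: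
a rank `Q'`, a factor `κ ≥ 1`, a β-INDEPENDENT width map `wd` and a threshold `β₃` such that at every `β ≥ β₃` and every length `ξ ≥ 1`,
cold pressure modulo a light multiplet of rank `Q` at rate `1/ξ` (W-currency) implies the light-code certificate of rank `Q'` at rate
`1/(κ ξ)`.  No unit map, no pin, no coupling set — serves the per-β and the cofinal bills alike (`blindGivenMultiplet`-shape families follow
by choice).  The dynamical sector-blindness wall of N itself (no order parameter for the magnetic `ℤ_{|π₁|}` symmetry at weak coupling);
as typed this is CLUSTERING-GIVEN-MULTIPLET at the certificate level: conditional on S⁺cof (`MultipletPinnedOn`) it is ≥ N_cof (`IRnscCof`) and conditional on S⁺ it is ≥ N (crit-4 K1 ⇒, crit-1 V22/V23) — an attack-surface split, NOT a discount on N; the flux-code vocabulary locates nothing beyond that.  Why it might fail: species charged under the centre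
flux see the sector (wd unbounded); certificate needs a spectral projector the W-currency does not determine.  Sources: tHooft1979;
BravyiHastingsMichalakis2010 (dictionary only); `Theorems/BalabanLadderIRLightCode{Defs,Blindness}`. -/
def BlindAt : Prop :=
  ∀ (G : Type) [Group G] [TopologicalSpace G] [IsTopologicalGroup G] [CompactSpace G],
    IsCompactSimpleLieGroup G → ¬ SimplyConnectedSpace G →
    letI : MeasurableSpace G := borel G
    haveI : BorelSpace G := ⟨rfl⟩
    ∀ (r : LatticeRep G) (Q : ℕ), ∃ (Q' κ : ℕ) (wd : YMSpecies G → YMSpecies G → ℕ) (β₃ : ℝ), 1 ≤ κ ∧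
      ∀ β : ℝ, β₃ ≤ β → ∀ ξ : ℕ, 1 ≤ ξ → LightMultipletPressureAt r β Q (1 / (ξ : ℝ)) →
        LightCodeCertificateAt r β Q' (1 / ((κ * ξ : ℕ) : ℝ)) wd

/-- **PXᴷcof `PinnedRankExitCof` — the PINNED cofinal exit family** Intermediate `Prop` (the conclusion of a PROVED seam from the hypotheses above; by itself open Yang–Mills content). (intermediate; PROVED from K1ᴷ ∧ Xᴷ ∧ floors by `pinnedRankExitCof_of`,
and implied by LINE D's per-β `PinnedRankExit`): a rank `Q` such that for every `θ > 0`, `S₀`: a pin `T`, and cofinally many couplings `β`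
carrying a rank-`Q` `θ`-exit of half-side `S ≥ S₀` with `a β · (2S+1) ≤ T`. -/
def PinnedRankExitCof : Prop :=
  ∀ (G : Type) [Group G] [TopologicalSpace G] [IsTopologicalGroup G] [CompactSpace G],
    IsCompactSimpleLieGroup G → ¬ SimplyConnectedSpace G →
    letI : MeasurableSpace G := borel G
    haveI : BorelSpace G := ⟨rfl⟩
    ∀ (r : LatticeRep G) (a : ℝ → ℝ), (∀ β, 0 < a β) → Tendsto a atTop (𝓝 0) → LowerBounds G r a →
      ∃ Q : ℕ, ∀ θ : ℝ, 0 < θ → ∀ S₀ : ℕ, ∃ T : ℝ, ∀ x : ℝ, ∃ β : ℝ, x ≤ β ∧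
        ∃ S : ℕ, S₀ ≤ S ∧ a β * ((2 * S + 1 : ℕ) : ℝ) ≤ T ∧ RqExit r β Q θ S

/-- **S⁺cof `MultipletPinnedOn` — the W-currency pinned to the floor ON A COFINAL COUPLING SET** Intermediate `Prop` (the conclusion of a PROVED seam from the hypotheses above; by itself open Yang–Mills content). (the strengthened statement of the lens,
cofinal form). -/
def MultipletPinnedOn : Prop :=
  ∀ (G : Type) [Group G] [TopologicalSpace G] [IsTopologicalGroup G] [CompactSpace G],
    IsCompactSimpleLieGroup G → ¬ SimplyConnectedSpace G →
    letI : MeasurableSpace G := borel G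
    haveI : BorelSpace G := ⟨rfl⟩
    ∀ (r : LatticeRep G) (a : ℝ → ℝ), (∀ β, 0 < a β) → Tendsto a atTop (𝓝 0) → LowerBounds G r a →
      ∃ (Q : ℕ) (T : ℝ) (Bset : Set ℝ), (∀ x : ℝ, ∃ β ∈ Bset, x ≤ β) ∧
        ∀ β ∈ Bset, ∃ ξ : ℕ, 1 ≤ ξ ∧ a β * (ξ : ℝ) ≤ T ∧ LightMultipletPressureAt r β Q (1 / (ξ : ℝ))

/-! ## §3 The Bset light-code rate seam (PROVED; `gapInUnits_of_lightCode_pinned` with onset and pin on a coupling set) -/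

section Seam

variable {G : Type} [Group G] [TopologicalSpace G] [IsTopologicalGroup G] [CompactSpace G]
  [MeasurableSpace G] [BorelSpace G]

/-- **Rate seam on a set of couplings (PROVED).**  A light-code onset `hon` and a pin `hpin` ON `Bset` (with `0 < T` explicit) give the
`GapInUnits` clustering family ON `Bset` with rate `c₁ = 1/T` — verbatim the landed `FluxCodeBlindness.gapInUnits_of_lightCode_pinned`
with the binder `β ∈ Bset →` threaded through (the per-β kernel `abs_latticeConnectedCorr_le_of_lightCodeAt` never saw other couplings). -/
theorem gapOn_of_lightCode_pinned_onSet (r : LatticeRep G) (a : ℝ → ℝ) (ha : ∀ β, 0 < a β)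
    (ha0 : Tendsto a atTop (𝓝 0)) (Bset : Set ℝ) {Q : ℕ} {wd : YMSpecies G → YMSpecies G → ℕ} {ξ : ℝ → ℕ} {β₂ : ℝ}
    (hon : ∀ β ∈ Bset, β₂ ≤ β → 1 ≤ ξ β ∧ LightCodeCertificateAt r β Q (1 / (ξ β : ℝ)) wd)
    {T β₆ : ℝ} (hT : 0 < T) (hpin : ∀ β ∈ Bset, β₆ ≤ β → a β * (ξ β : ℝ) < T) :
    ∃ (c₁ β₂ : ℝ) (S₁ : ℝ → ℕ), 0 < c₁ ∧ ∀ A B : YMSpecies G, ∃ C : ℝ, ∀ β ∈ Bset, β₂ ≤ β →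
      ∀ S n : ℕ, S₁ β ≤ S → n ≤ S →
        |latticeConnectedCorr r.ρ β (2 * S + 1) A.F B.F n| ≤ C * Real.exp (-(c₁ * a β * n)) := by
  classical
  -- eventually `a β ≤ T`
  obtain ⟨β₇, hβ₇⟩ : ∃ β₇ : ℝ, ∀ β : ℝ, β₇ ≤ β → a β ≤ T := by
    have hev : ∀ᶠ β in atTop, a β < T := ha0.eventually (gt_mem_nhds hT)
    obtain ⟨β₇, h⟩ := Filter.eventually_atTop.1 hev
    exact ⟨β₇, fun β hβ => (h β hβ).le⟩
  set β₈ : ℝ := max (max β₂ β₆) (max β₇ 0) with hβ₈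
  -- the per-β package at the uniform rate `a β / T` on `Bset`
  have hR : ∀ β ∈ Bset, β₈ ≤ β → ∃ S₂ : ℕ, ∃ C₀ : ℝ, 0 ≤ C₀ ∧
      (∀ S : ℕ, S₂ ≤ S → C₀ * ((2 * S + 1 : ℕ) : ℝ) ^ 3 * Real.exp (-(a β / T * S / 2)) ≤ 1) ∧
      (∀ (A B : YMSpecies G) (CA CB : ℝ), (∀ U, |A.F U| ≤ CA) → (∀ U, |B.F U| ≤ CB) →
        ∀ S n : ℕ, S₂ ≤ S → n ≤ S → wd A B < n → 2 * wd A B ≤ S → ∀ δ : ℝ, 0 < δ →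
        ∃ (d q : ℕ) (T' Ao Bo : Euc d →L[ℝ] Euc d) (e : Fin (q + 1) → Euc d) (θ : Fin (q + 1) → ℝ),
          q ≤ Q ∧ LightCodeModel T' Ao Bo e θ (Real.exp (-(a β / T))) (Real.exp (-(a β / T * S))) (wd A B) ∧
          ‖Ao‖ ≤ CA ∧ ‖Bo‖ ≤ CB ∧
          (∀ m : ℕ, S + 1 ≤ 2 * m → secExcess T' θ m ≤ C₀ * ((2 * S + 1 : ℕ) : ℝ) ^ 3 * Real.exp (-(a β / T * m))) ∧
          |latticeConnectedCorr r.ρ β (2 * S + 1) A.F B.F n - modelCorr T' Ao Bo S n (wd A B)| ≤ δ) := by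
    intro β hβB hβ
    have hβ2 : β₂ ≤ β := le_trans (le_trans (le_max_left _ _) (le_max_left _ _)) hβ
    have hβ6 : β₆ ≤ β := le_trans (le_trans (le_max_right _ _) (le_max_left _ _)) hβ
    obtain ⟨hξ1, C₀, hC₀, L, hL⟩ := hon β hβB hβ2
    have hμ0 : 0 < a β / T := div_pos (ha β) hT
    obtain ⟨S₀, hS₀⟩ := Filter.eventually_atTop.1 (volumeFloor_eventually C₀ (a β / T) hC₀ hμ0)
    have hξpos : (0 : ℝ) < (ξ β : ℝ) := by exact_mod_cast hξ1
    have hrate : a β / T ≤ 1 / (ξ β : ℝ) := by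
      rw [div_le_div_iff₀ hT hξpos]
      have := hpin β hβB hβ6
      linarith
    refine ⟨max L S₀, C₀, hC₀, fun S hS => hS₀ S (le_trans (le_max_right _ _) hS), ?_⟩
    intro A B CA CB hCA hCB S n hS hn hwn h2w δ hδ
    obtain ⟨d, q, T', Ao, Bo, e, θ, hqQ, hM, hAo, hBo, hXb, hclose⟩ :=
      hL A B CA CB hCA hCB S n (le_trans (le_max_left _ _) hS) hn hwn h2w δ hδ
    refine ⟨d, q, T', Ao, Bo, e, θ, hqQ, ?_, hAo, hBo, ?_, hclose⟩
    · obtain ⟨hT', he, heig, hθ0, hθ, hcon, hcA, hcB⟩ := hM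
      have hρ : Real.exp (-(1 / (ξ β : ℝ))) ≤ Real.exp (-(a β / T)) := Real.exp_le_exp.2 (by linarith)
      have hε : Real.exp (-(1 / (ξ β : ℝ) * S)) ≤ Real.exp (-(a β / T * S)) :=
        Real.exp_le_exp.2 (by nlinarith [Nat.cast_nonneg (α := ℝ) S])
      refine ⟨hT', he, heig, hθ0, hθ, fun v hv => (hcon v hv).trans ?_, fun k l => (hcA k l).trans hε,
        fun k l => (hcB k l).trans hε⟩
      exact mul_le_mul_of_nonneg_right hρ (norm_nonneg _)
    · intro m hm
      refine (hXb m hm).trans ?_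
      have hV : 0 ≤ C₀ * ((2 * S + 1 : ℕ) : ℝ) ^ 3 := by positivity
      refine mul_le_mul_of_nonneg_left (Real.exp_le_exp.2 ?_) hV
      nlinarith [Nat.cast_nonneg (α := ℝ) m]
  -- the size threshold `S₁ β` (junk `0` off `Bset` or below `β₈`)
  let S₁ : ℝ → ℕ := fun β => if h : β ∈ Bset ∧ β₈ ≤ β then Classical.choose (hR β h.1 h.2) else 0
  refine ⟨1 / T, β₈, S₁, by positivity, fun A B => ?_⟩
  obtain ⟨CA, hCA⟩ := A.bounded
  obtain ⟨CB, hCB⟩ := B.bounded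
  set w : ℕ := wd A B with hwdef
  refine ⟨max (((Q + 1 : ℕ) : ℝ) * (CA * CB * Real.exp (2 * w) * 7) + 3 * ((Q + 1 : ℕ) : ℝ) ^ 2 * (CA + CB + 1))
      (2 * (CA * CB) * Real.exp (2 * w)), fun β hβB hβ S n hS hn => ?_⟩
  have hS₁ : S₁ β = Classical.choose (hR β hβB hβ) := dif_pos ⟨hβB, hβ⟩
  obtain ⟨C₀, hC₀, hK, hP⟩ := Classical.choose_spec (hR β hβB hβ)
  rw [hS₁] at hS
  have hβ7 : β₇ ≤ β := le_trans (le_trans (le_max_left _ _) (le_max_right _ _)) hβ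
  have hμ0 : 0 ≤ a β / T := (div_pos (ha β) hT).le
  have hμ1 : a β / T ≤ 1 := by
    rw [div_le_one hT]
    exact hβ₇ β hβ7
  have hmain := abs_latticeConnectedCorr_le_of_lightCodeAt r A B hCA hCB (β := β) (Q := Q) (w := w) hμ0 hμ1 hC₀ hK
    (fun S n hS hn hwn h2w δ hδ => hP A B CA CB hCA hCB S n hS hn hwn h2w δ hδ) S n hS hn
  have hexp : Real.exp (-(a β / T * n)) = Real.exp (-(1 / T * a β * n)) := by
    congr 1
    ring
  rw [hexp] at hmain
  exact hmain

end Seam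

end Summit.QuantumFields.YangMills.Cruxes.IR.RankPurity
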